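import Summits.BirchSwinnertonDyer.Rank1Residual.X11b.ClassClosureWeightKChainLever
import HarnessLib

/-!
# Class X11b = N8 at `p ≥ 5` (lane CLASS-CLOSURE, seat `cc-typer-3`): MINIMAL PAIRS — ONE
# unit-coefficient certificate `Iwasawa.UnitCoeffAt W p 1` gives Mazur's main conjecture AND
# Schneider's non-degeneracy at the pair (iw-1's §3), hence `BSD(E,p)` through the lever with NO
# regulator certificate, NO (ram), NO Hida-family transfer (cell `b2b-bsdres`)

HONEST FRAMING (verbatim, cell `b2b-bsdres`, run/shared/lean/b2b/bsd-rank1-residual/): the goal of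
the cell is to DELETE the COMBINATION-SHAPED residual classes for ALL analytic-rank `≤ 1` curves
over `ℚ` — "full BSD formula for every rank `≤ 1` curve in class `C`" assembled STRICTLY from
published theorems — so that the rank-`≤ 1` remainder becomes exactly the CONSTRUCTION-SHAPED
classes, which are TYPED (missing-input Props), NOT attempted; this is not "finishing BSD".
Lane CLASS-CLOSURE (coordinator ruling 2026-08-21T04:07Z): prove what is provable now; shrink each
hard class to its core with data; no claim beyond stated classes. THEOREMS ONLY (no definition, no
named fact, no `sorry`); nothing booked; no label / RESIDUAL-MAP mark changes; X11b stays
CONSTRUCTION-SHAPED; every theorem is CONDITIONAL on the named published facts and the per-pair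
certificate it lists; a unit-coefficient row is EVIDENCE / instrumentation (B-5 / IWASAWA-CENSUS) —
its worth is referee A's / the lane's ruling; Greenberg's `μ`-conjecture and Schneider's conjecture
(barrier `PAdicHeightNondegeneracy`) are NEVER asserted class-wide.

## What this file does (the `p ≥ 5` twin of x11b3's `X11b/Three/UnitCoeffJoin.lean`, WITHOUT (ram))

A MINIMAL PAIR is an X11b pair `(E, p)` whose Néron-normalised Mazur–Tate–Teitelbaum series `ϖ·L_p`
has a UNIT coefficient at index `1 + e` (`e = 1` split / `0` non-split), i.e. iw-1's certificate
`Iwasawa.UnitCoeffAt W p 1` (`λ_an = r_an + e`, `μ_an = 0`). iw-1's kernel theorems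
(`Iwasawa/UnitCoefficientCertificateMultiplicative.lean` §3, IWASAWA-CENSUS §4.4 (1)) give at a
multiplicative `p ≠ 2` with `ρ_{E,p^∞}` onto, from Kato–Wuthrich A32 and that ONE certificate:
Mazur's main conjecture at the pair (`mazurMainConjectureAt_of_unitCoeffAt_mordellWeilRank_of_five_le`,
the squeeze — no `μ`-chain, no Wan / EPW) AND, via Stein–Wuthrich Thm. 6.1 clause 2, Schneider's
conjecture for THE canonical height + `Ш(E/ℚ)[p^∞]` finite
(`schneider_and_finite_sha_of_unitCoeffAt_{split,nonsplit}`). This file JOINS them with this seat's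
analytic-rank-ONE lever (`bsdp_of_mazurMainConjectureAt_of_{nonsplit,split_of_five_le}_of_schneider`,
p252284; exceptional twin `…_split_of_conjecture_of_schneider`, p274916):
* `bsdp_of_unitCoeffAt_one_of_nonsplit` — X11b, `p ≥ 5`, `ρ̄` onto, NON-SPLIT: `UnitCoeffAt W p 1 ⟹
  BSD(E,p)` from Kato–Wuthrich A32, Stein–Wuthrich Thm 6.1 + §4.2 (non-split), Disegni 2020 Thm 1,
  GZK, modularity — ONE certificate, nothing else per pair;
* `bsdp_of_unitCoeffAt_one_of_split` — SPLIT: the same + Disegni's (∗) (a second multiplicative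
  prime) OR the lane's conjecture `RelativeExceptionalLeadingTermAt W p`;
* `bsdp_of_unitCoeffAt_one` (both signs), `mazurMC_and_finite_sha_of_unitCoeffAt_one` (by-products),
  `forall_bsdp_five_le_of_unitCoeffAt_one` (class level).
READING (EVIDENCE; no count moved; nothing booked): of N8's 138 `¬Ram` cells at `p ≥ 5`, cc-lead
RULING (8)(a) reports 56 rows certified as `UnitCoeffAt(W,p,1)` (minimal pairs) — on those (if
surjective, and with the nmult bit at a split `p`) this road needs NO REGMULT row and NONE of the
weight-`k` chain's facts (Hida member / EPW / Wan and their flags); the 82 "MuAnZero-only" rows stay on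
the T-WK road (`ClassClosureWeightKChainLever`). The same holds verbatim on (ram) minimal pairs.
Tier / label = referee A + x11b3 lead.

References: [Wuthrich2014] Thm. 3, Cor. 19 (pp. 382, 398–399); [SteinWuthrich2013] Thm. 6.1 (p. 20),
§4.2, §11 remark (p. 29); [GreenbergVatsal2000] p. 4; [Disegni2020] Thm. 1, (∗); [Miller2011LMS]
Def. 1.1; [KolyvaginEulerSystems1990] Thm. A; HOME/IWASAWA-CENSUS.md §4.4 (1);
HOME/class-closure/O2/TYPER-3.md §9 (GEN 3).
-/

set_option autoImplicit false

noncomputable section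

open scoped Classical MatrixGroups ModularForm

open CongruenceSubgroup WeierstrassCurve Literature.NumberTheory.EllipticCurves
  Literature.NumberTheory.EllipticCurves.ModularForms
  Literature.NumberTheory.EllipticCurves.Rank1Residual
  Literature.NumberTheory.EllipticCurves.Rank1Residual.Typed
  Literature.NumberTheory.EllipticCurves.Skinner2016
  Literature.NumberTheory.EllipticCurves.SteinWuthrich2013
  Literature.NumberTheory.EllipticCurves.Wuthrich2014
  Literature.NumberTheory.EllipticCurves.Disegni2020
  Literature.NumberTheory.EllipticCurves.GreenbergVatsal2000
  Literature.NumberTheory.EllipticCurves.EmertonPollackWeston2006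
  Summit.BirchSwinnertonDyer.Rank1Residual.X1.MuLambda

namespace Summit.BirchSwinnertonDyer.Rank1Residual.X11b.ClassClosure

open X11a

section MinimalPair

variable (W : WeierstrassCurve ℚ) [W.IsElliptic] [W.IsGloballyMinimal] (p : ℕ) [Fact p.Prime]

omit [W.IsGloballyMinimal] in
/-- In analytic rank one a certificate at index `1` is the certificate at index `rank E(ℚ)` that
iw-1's minimal-pair theorems take (GZK). [cite: KolyvaginEulerSystems1990, Thm. A] -/
theorem unitCoeffAt_mordellWeilRank_of_one (hGZK : rank_eq_analyticRank_of_analyticRank_le_one)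
    (hr : W.analyticRank = 1) (hcert : Iwasawa.UnitCoeffAt W p 1) :
    Iwasawa.UnitCoeffAt W p W.mordellWeilRank := by
  rw [mordellWeilRank_eq_one_of_analyticRank hGZK hr]
  exact hcert

/-- **MINIMAL PAIR, NON-SPLIT, `p ≥ 5`, `ρ̄_{E,p}` onto: ONE certificate closes `BSD(E,p)` modulo the
named facts.** For an X11b pair non-split at `p`: `Iwasawa.UnitCoeffAt W p 1` (the coefficient of `T¹`
of `ϖ·L_p` is a `p`-adic unit) ⟹ `BSD(E,p)`, from Kato–Wuthrich A32 (`hKato`), Stein–Wuthrich Thm.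
6.1 non-split (`hJn`) + §4.2 height existence (`hHn`), Disegni 2020 Thm. 1 (`hD`, non-split clause,
any odd `p`), GZK (`hGZK`), modularity (`hpar`). Route: the certificate gives Mazur's main conjecture
at the pair (iw-1's squeeze `mazurMainConjectureAt_of_unitCoeffAt_mordellWeilRank_of_five_le`) AND
Schneider's conjecture for THE §4.2 datum (`schneider_and_finite_sha_of_unitCoeffAt_nonsplit`, the
data instantiated from tree theorems), which feed p252284's
`bsdp_of_mazurMainConjectureAt_of_nonsplit_of_schneider`. NO regulator certificate, NO (ram), NO
Hida/EPW/Wan fact, NO `#Ш_an` hypothesis. CONDITIONAL; nothing booked; X11b stays CONSTRUCTION-SHAPED.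
[cite: Wuthrich2014, Thm. 3 (p. 382) and Cor. 19 proof (p. 399)] [cite: SteinWuthrich2013, Thm. 6.1 (p. 20), §4.2, §11 remark (p. 29)]
[cite: Disegni2020, Thm. 1 (§1.2)] [cite: Miller2011LMS, Def. 1.1] -/
theorem bsdp_of_unitCoeffAt_one_of_nonsplit
    (hKato : kato_charIdeal_dvd_multiplicative_of_surjective)
    (hJn : thm61_nonsplitMultiplicative) (hHn : exists_isMultCanonical)
    (hD : thm1_padicBSD_rankOne_multiplicative)
    (hGZK : rank_eq_analyticRank_of_analyticRank_le_one) (hpar : nonempty_modularParametrizationData)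
    (hX : ClassX11b W p) (hp : 5 ≤ p) (hsurj : Surj W p)
    (hns : ¬ W.HasSplitMultiplicativeReductionAtPrime p) (hcert : Iwasawa.UnitCoeffAt W p 1) :
    BSDp W p := by
  have hr : W.analyticRank = 1 := hX.1
  have hp2 : p ≠ 2 := hX.2.1
  have hmult : W.HasMultiplicativeReductionAtPrime p := hX.2.2.1
  have hsurj' : ∀ n : ℕ, W.HasSurjectiveModNGaloisRep (p ^ n : ℕ) :=
    kato_charIdeal_dvd_multiplicative_of_surjective.surjective_pow_of_five_le W p hp hsurj
  have hcert' : Iwasawa.UnitCoeffAt W p W.mordellWeilRank :=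
    unitCoeffAt_mordellWeilRank_of_one W p hGZK hr hcert
  have hMC : X2.MazurMainConjectureAt W p :=
    Iwasawa.mazurMainConjectureAt_of_unitCoeffAt_mordellWeilRank_of_five_le W p hKato hp hmult hsurj
      hcert'
  refine bsdp_of_mazurMainConjectureAt_of_nonsplit_of_schneider W p hJn hHn hGZK hpar
    (fun hf ϖ hϖ0 hϖ q hq0 hq1 hqj L hL Dh hDh =>
      thm1_padicBSD_rankOne_multiplicative.nonsplit hD W p hp2 hmult hr hf ϖ hϖ0 hϖ hns hq0 hq1 hqj L
        hL Dh hDh)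
    hX hns hMC ?_
  -- Schneider for THE §4.2 datum, from the certificate (data instantiated from tree theorems)
  intro q Dh hq0 hq1 hqj hDh
  obtain ⟨κ, hκ, γ, hγ, hγ'⟩ := exists_isCyclotomic_isTopGenerator_isCyclotomicVariable_holds p
  obtain ⟨D⟩ := W.nonempty_selmerDualData_holds κ γ hγ
  haveI : NeZero (W.conductorNorm ℤ) := ⟨(W.conductorNorm_pos_holds).ne'⟩
  obtain ⟨Dm⟩ := hpar W
  obtain ⟨ϖ, -, hϖ, -⟩ := Dm.exists_rat_mul_realPeriodRat_eq_plusPeriod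
  obtain ⟨L, hL⟩ := exists_isMultPAdicLFunctionOf_neg_one_of_nonsplit Dm.isNewformOf hmult hns
  exact (Iwasawa.schneider_and_finite_sha_of_unitCoeffAt_nonsplit W p hKato hJn hp2 hmult hns hsurj'
    hcert' q hq0 hq1 hqj hκ hγ hγ' _ Dm.isNewformOf D ϖ hϖ L hL Dh hDh).1

/-- **MINIMAL PAIR, SPLIT, `p ≥ 5`, `ρ̄_{E,p}` onto: ONE certificate + the nmult bit (or the
conjecture).** For an X11b pair split at `p`: `Iwasawa.UnitCoeffAt W p 1` (the coefficient of `T²` of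
`ϖ·L_p` is a unit) ⟹ `BSD(E,p)`, from Kato–Wuthrich A32, Stein–Wuthrich Thm. 6.1 split (`hJs`) + the
modified §4.2 height (`hHs`), Disegni 2020 Thm. 1 (`hD`), GZK, modularity, and (γ): a second
multiplicative prime (Disegni's (∗)) OR the lane's EVIDENCE-labelled conjecture
`RelativeExceptionalLeadingTermAt W p`. Route: squeeze ⟹ Mazur's main conjecture; SW Thm 6.1 clause 2
⟹ Schneider for THE modified datum (`schneider_and_finite_sha_of_unitCoeffAt_split`); then p252284 /
p274916. NO regulator certificate, NO (ram), NO Hida/EPW/Wan. CONDITIONAL (on an unproved conjecture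
only if (γ)'s second disjunct is used); nothing booked.
[cite: Wuthrich2014, Thm. 3 (p. 382) and Cor. 19 proof (p. 399)] [cite: SteinWuthrich2013, Thm. 6.1 (p. 20), §4.2, §11 remark (p. 29)]
[cite: Disegni2020, Thm. 1 (§1.2), hypothesis (∗)] [cite: Miller2011LMS, Def. 1.1] -/
theorem bsdp_of_unitCoeffAt_one_of_split
    (hKato : kato_charIdeal_dvd_multiplicative_of_surjective)
    (hJs : thm61_splitMultiplicative) (hHs : exists_isSplitMultCanonical)
    (hD : thm1_padicBSD_rankOne_multiplicative)
    (hGZK : rank_eq_analyticRank_of_analyticRank_le_one) (hpar : nonempty_modularParametrizationData)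
    (hX : ClassX11b W p) (hp : 5 ≤ p) (hsurj : Surj W p)
    (hsplit : W.HasSplitMultiplicativeReductionAtPrime p) (hcert : Iwasawa.UnitCoeffAt W p 1)
    (hγ : (∃ (m : ℕ) (_ : Fact m.Prime), m ≠ p ∧ W.HasMultiplicativeReductionAtPrime m) ∨
      RelativeExceptionalLeadingTermAt W p) :
    BSDp W p := by
  have hr : W.analyticRank = 1 := hX.1
  have hp2 : p ≠ 2 := hX.2.1
  have hmult : W.HasMultiplicativeReductionAtPrime p := hX.2.2.1
  have hsurj' : ∀ n : ℕ, W.HasSurjectiveModNGaloisRep (p ^ n : ℕ) :=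
    kato_charIdeal_dvd_multiplicative_of_surjective.surjective_pow_of_five_le W p hp hsurj
  have hcert' : Iwasawa.UnitCoeffAt W p W.mordellWeilRank :=
    unitCoeffAt_mordellWeilRank_of_one W p hGZK hr hcert
  have hMC : X2.MazurMainConjectureAt W p :=
    Iwasawa.mazurMainConjectureAt_of_unitCoeffAt_mordellWeilRank_of_five_le W p hKato hp hmult hsurj
      hcert'
  -- Schneider for THE modified §4.2 datum, from the certificate
  have hSch : ∀ (Dq : TateParameterData W p) (Dh : PAdicHeightData W p),
      IsSplitMultCanonical Dh Dq → SchneiderConjecture Dh := by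
    intro Dq Dh hDh
    obtain ⟨κ, hκ, γ, hγ, hγ'⟩ := exists_isCyclotomic_isTopGenerator_isCyclotomicVariable_holds p
    obtain ⟨D⟩ := W.nonempty_selmerDualData_holds κ γ hγ
    haveI : NeZero (W.conductorNorm ℤ) := ⟨(W.conductorNorm_pos_holds).ne'⟩
    obtain ⟨Dm⟩ := hpar W
    obtain ⟨ϖ, -, hϖ, -⟩ := Dm.exists_rat_mul_realPeriodRat_eq_plusPeriod
    obtain ⟨L, hL⟩ := exists_isSplitMultPAdicLFunctionOf hsplit Dm.isNewformOf
    exact (Iwasawa.schneider_and_finite_sha_of_unitCoeffAt_split W p hKato hJs hp2 hmult hsurj' hcert'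
      hsplit Dq hκ hγ hγ' _ Dm.isNewformOf D ϖ hϖ L hL Dh hDh).1
  rcases hγ with hm | hC
  · exact bsdp_of_mazurMainConjectureAt_of_split_of_five_le_of_schneider W p hJs hHs hGZK hpar
      (fun hf ϖ hϖ0 hϖ hp5' hm' Dq L hL Dh hDh =>
        thm1_padicBSD_rankOne_multiplicative.split hD W p hp2 hmult hr hf ϖ hϖ0 hϖ hsplit hp5' hm' Dq
          L hL Dh hDh)
      hX hsplit hp hm hMC hSch
  · exact bsdp_of_mazurMainConjectureAt_of_split_of_conjecture_of_schneider W p hJs hHs hGZK hpar hX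
      hsplit hMC hC hSch

/-- **MINIMAL PAIR, both reduction signs**: on X11b at `p ≥ 5` with `ρ̄_{E,p}` onto,
`Iwasawa.UnitCoeffAt W p 1 ⟹ BSD(E,p)` from Kato–Wuthrich A32, Stein–Wuthrich Thm. 6.1 ×2 + §4.2 ×2,
Disegni 2020 Thm. 1, GZK, modularity — plus, ONLY if `E` is split at `p`, a second multiplicative
prime or the conjecture `RelativeExceptionalLeadingTermAt W p`. ONE per-pair certificate; no
regulator row, no (ram), no Hida-family facts. CONDITIONAL; nothing booked; X11b stays
CONSTRUCTION-SHAPED. [cite: Wuthrich2014, Thm. 3 (p. 382) and Cor. 19 proof (p. 399)]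
[cite: SteinWuthrich2013, Thm. 6.1 (p. 20), §4.2, §11 remark (p. 29)] [cite: Disegni2020, Thm. 1 (§1.2), hypothesis (∗)]
[cite: Miller2011LMS, Def. 1.1] -/
theorem bsdp_of_unitCoeffAt_one
    (hKato : kato_charIdeal_dvd_multiplicative_of_surjective)
    (hJn : thm61_nonsplitMultiplicative) (hJs : thm61_splitMultiplicative)
    (hHn : exists_isMultCanonical) (hHs : exists_isSplitMultCanonical)
    (hD : thm1_padicBSD_rankOne_multiplicative)
    (hGZK : rank_eq_analyticRank_of_analyticRank_le_one) (hpar : nonempty_modularParametrizationData)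
    (hX : ClassX11b W p) (hp : 5 ≤ p) (hsurj : Surj W p) (hcert : Iwasawa.UnitCoeffAt W p 1)
    (hγ : W.HasSplitMultiplicativeReductionAtPrime p →
      (∃ (m : ℕ) (_ : Fact m.Prime), m ≠ p ∧ W.HasMultiplicativeReductionAtPrime m) ∨
        RelativeExceptionalLeadingTermAt W p) :
    BSDp W p := by
  by_cases hsplit : W.HasSplitMultiplicativeReductionAtPrime p
  · exact bsdp_of_unitCoeffAt_one_of_split W p hKato hJs hHs hD hGZK hpar hX hp hsurj hsplit hcert
      (hγ hsplit)
  · exact bsdp_of_unitCoeffAt_one_of_nonsplit W p hKato hJn hHn hD hGZK hpar hX hp hsurj hsplit hcert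

/-- **By-products on a certified minimal pair** (no further input): Mazur's main conjecture at
`(E, p)` and `Ш(E/ℚ)[p^∞]` finite — iw-1's §3 read on X11b at `p ≥ 5` with `ρ̄` onto (the §4.2 datum
for the finiteness clause exists by `hHn` / `hHs`). CONDITIONAL; nothing booked.
[cite: Wuthrich2014, Thm. 3 (p. 382) and Cor. 19 proof (p. 399)] [cite: SteinWuthrich2013, Thm. 6.1 (p. 20), §11 remark (p. 29)] -/
theorem mazurMC_and_finite_sha_of_unitCoeffAt_one
    (hKato : kato_charIdeal_dvd_multiplicative_of_surjective)
    (hJn : thm61_nonsplitMultiplicative) (hJs : thm61_splitMultiplicative)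
    (hHn : exists_isMultCanonical) (hHs : exists_isSplitMultCanonical)
    (hGZK : rank_eq_analyticRank_of_analyticRank_le_one) (hpar : nonempty_modularParametrizationData)
    (hX : ClassX11b W p) (hp : 5 ≤ p) (hsurj : Surj W p) (hcert : Iwasawa.UnitCoeffAt W p 1) :
    X2.MazurMainConjectureAt W p ∧ Finite (AddCommGroup.primaryComponent W.sha p) := by
  have hr : W.analyticRank = 1 := hX.1
  have hp2 : p ≠ 2 := hX.2.1
  have hmult : W.HasMultiplicativeReductionAtPrime p := hX.2.2.1
  have hsurj' : ∀ n : ℕ, W.HasSurjectiveModNGaloisRep (p ^ n : ℕ) :=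
    kato_charIdeal_dvd_multiplicative_of_surjective.surjective_pow_of_five_le W p hp hsurj
  have hcert' : Iwasawa.UnitCoeffAt W p W.mordellWeilRank :=
    unitCoeffAt_mordellWeilRank_of_one W p hGZK hr hcert
  refine ⟨Iwasawa.mazurMainConjectureAt_of_unitCoeffAt_mordellWeilRank_of_five_le W p hKato hp hmult
    hsurj hcert', ?_⟩
  obtain ⟨κ, hκ, γ, hγ, hγ'⟩ := exists_isCyclotomic_isTopGenerator_isCyclotomicVariable_holds p
  obtain ⟨D⟩ := W.nonempty_selmerDualData_holds κ γ hγ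
  haveI : NeZero (W.conductorNorm ℤ) := ⟨(W.conductorNorm_pos_holds).ne'⟩
  obtain ⟨Dm⟩ := hpar W
  obtain ⟨ϖ, -, hϖ, -⟩ := Dm.exists_rat_mul_realPeriodRat_eq_plusPeriod
  by_cases hsplit : W.HasSplitMultiplicativeReductionAtPrime p
  · obtain ⟨L, hL⟩ := exists_isSplitMultPAdicLFunctionOf hsplit Dm.isNewformOf
    obtain ⟨Dq⟩ := (nonempty_tateParameterData_iff_holds (W := W) (p := p)).mpr hsplit
    obtain ⟨Dh, hDh⟩ := hHs W p hp2 Dq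
    exact (Iwasawa.schneider_and_finite_sha_of_unitCoeffAt_split W p hKato hJs hp2 hmult hsurj' hcert'
      hsplit Dq hκ hγ hγ' _ Dm.isNewformOf D ϖ hϖ L hL Dh hDh).2
  · obtain ⟨L, hL⟩ := exists_isMultPAdicLFunctionOf_neg_one_of_nonsplit Dm.isNewformOf hmult hsplit
    obtain ⟨q, ⟨hq0, hq1, hqj⟩, -⟩ := existsUnique_tateJ_eq_of_one_lt_norm
      (one_lt_norm_j_of_hasMultiplicativeReductionAtPrime (W := W) (p := p) hmult)
    obtain ⟨Dh, hDh⟩ := hHn W p hp2 hmult hsplit q hq0 hq1 hqj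
    exact (Iwasawa.schneider_and_finite_sha_of_unitCoeffAt_nonsplit W p hKato hJn hp2 hmult hsplit
      hsurj' hcert' q hq0 hq1 hqj hκ hγ hγ' _ Dm.isNewformOf D ϖ hϖ L hL Dh hDh).2

end MinimalPair

/-! ### Class level -/

/-- **N8 ∩ {`p ≥ 5`, `ρ̄_{E,p}` onto, MINIMAL PAIR}: `BSD(E,p)` ⇐ named published facts (Kato–Wuthrich
A32, Stein–Wuthrich Thm 6.1 ×2 + §4.2 ×2, Disegni 2020 Thm 1, GZK, modularity) + ONE per-pair
certificate `Iwasawa.UnitCoeffAt W p 1` (+ at a split `p`: the nmult bit or the conjecture).** No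
regulator certificate, no (ram), no Hida/EPW/Wan. No label change (referee A / x11b3 lead);
CONDITIONAL; nothing booked; X11b stays CONSTRUCTION-SHAPED.
[cite: Wuthrich2014, Thm. 3 (p. 382) and Cor. 19 proof (p. 399)] [cite: SteinWuthrich2013, Thm. 6.1 (p. 20), §4.2]
[cite: Disegni2020, Thm. 1 (§1.2), hypothesis (∗)] [cite: Miller2011LMS, Def. 1.1] -/
theorem forall_bsdp_five_le_of_unitCoeffAt_one
    (hKato : kato_charIdeal_dvd_multiplicative_of_surjective)
    (hJn : thm61_nonsplitMultiplicative) (hJs : thm61_splitMultiplicative)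
    (hHn : exists_isMultCanonical) (hHs : exists_isSplitMultCanonical)
    (hD : thm1_padicBSD_rankOne_multiplicative)
    (hGZK : rank_eq_analyticRank_of_analyticRank_le_one) (hpar : nonempty_modularParametrizationData) :
    ∀ (W : WeierstrassCurve ℚ) [W.IsElliptic] [W.IsGloballyMinimal] (p : ℕ) [Fact p.Prime],
      ClassX11b W p → 5 ≤ p → Surj W p → Iwasawa.UnitCoeffAt W p 1 →
      (W.HasSplitMultiplicativeReductionAtPrime p →
        (∃ (m : ℕ) (_ : Fact m.Prime), m ≠ p ∧ W.HasMultiplicativeReductionAtPrime m) ∨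
          RelativeExceptionalLeadingTermAt W p) → BSDp W p :=
  fun W _ _ p _ hX hp hsurj hcert hγ =>
    bsdp_of_unitCoeffAt_one W p hKato hJn hJs hHn hHs hD hGZK hpar hX hp hsurj hcert hγ

end Summit.BirchSwinnertonDyer.Rank1Residual.X11b.ClassClosure

end
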